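import Summits.BirchSwinnertonDyer.BirchSwinnertonDyer.Theorems.ManinLocalTwoThreeManinPrimeToAdditiveFiveLeRedFiveSevenStarredOfItems
import Summits.BirchSwinnertonDyer.BirchSwinnertonDyer.Theorems.ManinLocalTwoThreeManinPrimeToAdditiveFiveLeKatoReductionFiveLe
import Summits.BirchSwinnertonDyer.BirchSwinnertonDyer.Theorems.ManinLocalTwoThreeManinPrimeToAdditiveFiveLeReducibleResidueOfFacts
import Summits.BirchSwinnertonDyer.BirchSwinnertonDyer.Theorems.ManinLocalTwoThreeManinPrimeToAdditiveFiveLeReducibleResidueThirteenStub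
import Summits.BirchSwinnertonDyer.BirchSwinnertonDyer.Theorems.ManinLocalTwoThreeManinPrimeToAdditiveFiveLeDegreeUpThirteenOfOrdinaryTwistLaw
import Summits.BirchSwinnertonDyer.BirchSwinnertonDyer.Theorems.ManinLocalTwoThreeManinPrimeToAdditiveFiveLeUnstarredLawOfAcrossIsogeny
import Summits.BirchSwinnertonDyer.BirchSwinnertonDyer.Theorems.TeichmullerTwistDescentCellsOfKato
import HarnessLib

/-!
# Route `ManinLocalTwoThree`, residual crux C5 `ManinPrimeToAdditiveFiveLe`
# (stmt-BirchSwinnertonDyer-22969), line `upper_anchor` (skeleton v12): **THE BY-NAME LEDGER OF RECORD WITHOUT KP57 AND WITHOUT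
# DOKCHITSER–DOKCHITSER — C5 from SEVEN cite-only printed facts, TWO registered items of route `TwistFamilyManinDescent`
# (K15b stmt-27071, OrdinaryCornerManinResidual stmt-27552) and the imc cell's TWO registered conjectures (E-imc-5 at 5, 7; E-imc-9 at 13)**

Lead seat bsd-line-ml23-c5-p1 (gen 6); sequel of the width seat's υ5 (p628635, `…LedgerByName.lean`:
`maninPrimeToAdditiveFiveLe_of_prints_of_siblingItems_of_imcLaws`, which still takes KP57 `KPResidueManinUnitFiveSeven` (stmt-23810) and
Dokchitser–Dokchitser 2015 among its hypotheses). Two inputs are REMOVED here, no new mathematics of mine: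
* **KP57 (stmt-23810) is gone** — the whole `W[p]`-IRREDUCIBLE additive locus at `p ≥ 5` (Kosters–Pannekoek fibre included, every
  lattice-optimal datum at every level) is `p ∤ c` granted modularity (a binder of C5 itself) and Kato's F″ ONLY, by the cell
  pub/bsd-wall's `TeichmullerTwistDescent.not_dvd_c_of_kato` (Kato + unit Teichmüller twist + PROVED Chebotarev transfer witness; no Ihara
  lemma) — `coreKP_of_kato` below;
* **Dokchitser–Dokchitser 2015 Thm. 5.1 (1) is gone** — the STARRED `W[p]`-reducible residue at 5, 7 is read directly on stmt-27552 (its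
  potentially ordinary rows (5;9), (7;8), (7;10)) and on the orientation law (its potentially supersingular rows (5;8), (5;10), (7;9) are
  EMPTY under (U)), `coreRED57sharp_of_cns_of_items_of_optimalUnstarredNonGord` (lead gen 6, `…RedFiveSevenStarredOfItems.lean`) — the Manin
  transport θ and the bi-starred corner are no longer on the path.

So crux C5 BY NAME ⟸

  {F″, ČNS, Cremona ≤ 5·10⁵, EdK, EdG, MazurJ, GK 2017}                  (seven cite-only printed facts, statement-only `def`s)
  ∧ stmt-27071 ∧ stmt-27552                                            (open cruxes of route `TwistFamilyManinDescent`)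
  ∧ `OptimalUnstarredAcrossIsogeny 5` ∧ `OptimalUnstarredAcrossIsogeny 7` (E-imc-5) ∧ `OrdinaryRamifiedTwistLaw 13` (E-imc-9)

— the composition `ManinPrimeToAdditiveFiveLe_of` of skeleton v12 with its five stubs as hypotheses. ORIENTATION NOTE: route
`TwistFamilyManinDescent` lists C5 (22969) as a support item and its closed `Assembly` (stmt-25142) concludes C5 from ITS items; this theorem
consumes two of those items as hypotheses (no proof cycle: open `def`s), so only ONE of the two decompositions of C5 may be booked.
HONEST STATUS: conditional-result helper (`--supports … --as helper`); 27071, 27552, E-imc-5, E-imc-9 are OPEN; seven inputs are cite-only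
(F″ referee-flagged). Nothing here proves BSD, Manin's conjecture or C5.

References: [Kato2004Asterisque] (8.1.3), Thm. 9.7; [CesnaviciusNeururerSaha2023] Thm. 1.2; [EdixhovenManin1991] Thm. 3, Prop. 7, §4;
[Mazur1978] Thm. 1; [GealyKlagsbrun2017] Thm. 1; [KostersPannekoek2017] Cor. 2; [TateGCFT1967] §2.4; cell bsd-f2-manin MEMO-imc.md §3, §10.
-/

set_option autoImplicit false
-- the Theorems namespace of this sub repeats the summit name by design (D-0017 nested layout)
set_option linter.dupNamespace false

noncomputable section

open scoped Classical NumberField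

namespace Summit.BirchSwinnertonDyer.BirchSwinnertonDyer.Theorems

open WeierstrassCurve IsDedekindDomain NumberField
  Literature.NumberTheory.EllipticCurves Literature.NumberTheory.EllipticCurves.ModularForms
  Literature.NumberTheory.EllipticCurves.Rank1Residual
  Summit.BirchSwinnertonDyer.Rank1Residual.ManinAdditive
  Summit.BirchSwinnertonDyer.Rank1Residual.Additive
  Summit.BirchSwinnertonDyer.BirchSwinnertonDyer.Theses.EdixhovenFibreFiveSeven

/-- **The Kosters–Pannekoek fibre hypothesis `hKP` of p611587's composition (`W[p]` IRREDUCIBLE, `p ∈ {5, 7}`, a `ℚ_p`-point of order `p`,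
conductor-level lattice-optimal data) ⟸ modularity ∧ Kato's F″** — `TeichmullerTwistDescent.not_dvd_c_of_kato` (pub/bsd-wall); the
twist-minimality and torsion binders are idle. Replaces KP57 (stmt-23810) in the line's ledger. Conditional on the cite-only F″.
[cite: Kato2004Asterisque, (8.1.3) (p. 180), Thm. 9.7 (p. 189)] [cite: KostersPannekoek2017, Cor. 2] [cite: TateGCFT1967, §2.4] -/
theorem coreKP_of_kato (hnf : exists_isNewformOf)
    (hK57 : kato_neron_isIntegral_twistedSymbolSum_of_additive_five_le) :
    ∀ (W : WeierstrassCurve ℚ) [W.IsElliptic] [W.IsGloballyMinimal]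
      [NeZero (W.conductorNorm ℤ)] (D : ModularParametrizationData W (W.conductorNorm ℤ)),
      IsLatticeOptimal D → ∀ (p : ℕ) [Fact p.Prime], (p = 5 ∨ p = 7) → p ^ 2 ∣ W.conductorNorm ℤ →
      ¬ (∃ (W' : WeierstrassCurve ℚ) (q : ℕ), W'.IsElliptic ∧ W'.IsGloballyMinimal ∧
          q.Prime ∧ q ≠ 2 ∧ q ^ 2 ∣ W.conductorNorm ℤ ∧
          IsIsogenous W (W'.quadraticTwist (((-1 : ℤ) ^ (q / 2) * q : ℤ) : ℚ)) ∧
          ¬ q ^ 2 ∣ W'.conductorNorm ℤ) →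
      ¬ (∃ (W' : WeierstrassCurve ℚ) (d : ℤ), W'.IsElliptic ∧ W'.IsGloballyMinimal ∧
          (d = -1 ∨ d = 2 ∨ d = -2) ∧ 2 ^ 2 ∣ W.conductorNorm ℤ ∧
          IsIsogenous W (W'.quadraticTwist (d : ℚ)) ∧ ¬ 2 ^ 2 ∣ W'.conductorNorm ℤ) →
      W.HasIrreducibleModPGaloisRep p →
      (∃ P : (W.baseChange ℚ_[p]).toAffine.Point, p • P = 0 ∧ P ≠ 0) →
      ¬ (p : ℤ) ∣ D.maninConstant := by
  intro W _ _ _ D hD p _ h57 hpN _hodd _hdy hirr _hP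
  have h5 : 5 ≤ p := by rcases h57 with rfl | rfl <;> norm_num
  exact TeichmullerTwistDescent.not_dvd_c_of_kato hnf hK57 W p D h5
    (not_good_and_not_mult_of_sq_dvd_conductorNorm W hpN) hirr hD

/-- **C5 BY NAME ⟸ seven cite-only printed facts ∧ K15b (stmt-27071) ∧ OrdinaryCornerManinResidual (stmt-27552) ∧ E-imc-5 at 5 and 7 ∧
E-imc-9 at 13** (no KP57, no Dokchitser–Dokchitser). Composition: p611587's `…_of_kato57_of_cores` with the irreducible fibre from
`coreKP_of_kato` and the reducible residual from p608852 over RED(57♯) ⟸ ČNS ∧ 27071 ∧ 27552 ∧ (U) (`coreRED57sharp_of_cns_of_items_…`,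
with (U) ⟸ GK ∧ E-imc-5 via υ p626338) and RED(11) ⟸ MazurJ ∧ RED(13♯) ⟸ Cremona ∧ EdK ∧ E-imc-9(13) (p612408 ∘ p614544 ∘ υ2 p626766).
Conditional result; closes nothing. [cite: Kato2004Asterisque, Thm. 9.7 (p. 189)] [cite: EdixhovenManin1991, Thm. 3]
[cite: CesnaviciusNeururerSaha2023, Thm. 1.2] [cite: GealyKlagsbrun2017, Thm. 1] [cite: Mazur1978, Thm. 1] -/
theorem maninPrimeToAdditiveFiveLe_of_sevenPrints_of_twistFamilyItems_of_imcLaws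
    (hK57 : kato_neron_isIntegral_twistedSymbolSum_of_additive_five_le)
    (hCNS : cesnaviciusNeururerSaha_padicVal_maninConstant_le_modularDegree)
    (h500k : cremona_abs_maninConstant_eq_one_of_level_le_500000)
    (hEdK : edixhoven_not_dvd_maninConstant_of_kodairaSymbol_ne)
    (hEdG : edixhoven_not_dvd_maninConstant_of_not_potentiallyGoodOrdinary)
    (hJ : mazur_j_mem_of_not_hasIrreducibleModPGaloisRep_of_eleven_le)
    (hGK : gealyKlagsbrun2017_neronScalar_of_additive_potSupersingular)
    (hK15b : Summit.BirchSwinnertonDyer.BirchSwinnertonDyer.Theses.TwistFamilyManinDescent.SupersingularUnstarredStrongManinUnit)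
    (hOrd : Summit.BirchSwinnertonDyer.BirchSwinnertonDyer.Theses.TwistFamilyManinDescent.OrdinaryCornerManinResidual)
    (hE5 : OptimalUnstarredAcrossIsogeny 5) (hE7 : OptimalUnstarredAcrossIsogeny 7)
    (hO13 : OrdinaryRamifiedTwistLaw 13) :
    Summit.BirchSwinnertonDyer.BirchSwinnertonDyer.Theses.ManinLocalTwoThree.ManinPrimeToAdditiveFiveLe := by
  have h57 := coreRED57_of_cns_cremona_of_coreRED57sharp hCNS h500k
    (coreRED57sharp_of_cns_of_items_of_optimalUnstarredNonGord hCNS hK15b hOrd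
      (optimalUnstarredNonGord57_of_acrossIsogeny_of_gealyKlagsbrun hGK hE5 hE7))
  have h11 := coreRED11_of_mazurJ_of_coreRED13 hJ
    (coreRED13_of_cremona_of_coreRED13sharp h500k
      (red13sharp_of_edixhovenKodairaFact_of_ordinaryRamifiedTwistLaw hEdK hO13))
  intro hM hAU hC hnf
  exact maninLocalTwoThree_maninPrimeToAdditiveFiveLe_of_kato57_of_cores hK57 (coreKP_of_kato hnf hK57)
    (reducibleTwistMinimal_of_edixhoven_cns_of_cores hEdK hEdG hCNS h57 h11) hM hAU hC hnf

end Summit.BirchSwinnertonDyer.BirchSwinnertonDyer.Theorems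

end
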